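/-
Copyright (c) 2026 the pub-hodgecm-mathlib formalisation cell (harness21).  Prover seat hodgecm-mathlib-R90-C10-p05 (g3), R90-TF SLAB section S1 «Ch10-local», (S-W) line lead,
card (W-3) (dealer R90-C10-plan (g3) 2026-09-05T03:20:50Z, GO 03:27:06Z on census `R90/R90-C10-p05/g3/CENSUS-W3.v1.md` a05eeedd08a85999): U4Keys :182 WILD corner (S-W),
sub-branch (R-a) «`χ₁` trivial on the `σ`-fixed units», cell «`n ≥ δ`» of R90-C10-p02 (g3)'s partition (`CENSUS-SW-firstbrick.v1.md` f6499a1e §4): A θ-MULTIPLICATIVE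
CONCAVE (TWO-DEPTH) LEVEL DATUM EXISTS.  MODEL level, THEOREMS ONLY, hypothesis-first over ★ (O1) `K2E3ConcaveLevelIwahoriCharacterMin` (K2E3-p34 (g3)) and ★ D174
`K2E3IwahoriTwoDepthFactorisation` (K2E3-p14 (g9)).  NOT THE PAYER of :182 — Road-I base-case infrastructure.
-/
import Summits.HodgeConjecture.HodgeConjecture.Theorems.K2E3ConcaveLevelIwahoriCharacterMin   -- ★ (O1) p863752: `chi_apply_zero_zero_mul_of_concave_min` (θ multiplicative on `J_e`, minimal-`t` form, `|t|`-weighted inequalities)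
import Summits.HodgeConjecture.HodgeConjecture.Theorems.K2E3IwahoriTwoDepthFactorisation      -- ★ D174: `exists_subgroup_forall_mem_iff_twoDepth` (the two-depth group `J_{r,s;r',s'}` exists), `v_uniformiser_le_one`
import HarnessLib

/-!
# R90-TF S1 «Ch10-local» — U4Keys :182, THE WILD CORNER (S-W), sub-branch (R-a), cell `n ≥ δ`:
# A θ-MULTIPLICATIVE TWO-DEPTH LEVEL DATUM `e = (r, s; r', s')` EXISTS — «`r + r' = n`, `s + s' = 2δ`, and `θ(j) := χ₁(j₀₀)` is multiplicative on `J_e`»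
# [Tits1979 §1.15; BruhatTits1972 §6.4, (6.4.9); Roche1998 §3; MoyPrasad1996 §3; Serre1979 III §3]

Cell hodgecm-mathlib, R90-TF SLAB (HUMAN RULING «R90-TF SLAB — MAX PUSH»), crux item H413 = `stmt-HodgeConjecture-24833` (route `HCCMUnconditional`, no route verbs);
serves BY NAME the OPEN tier-0 socket (S-W) `…K2E3EllipticInputs.U4Keys.sig_K2E3KeysThmTwoContractingRamifiedCharOnePosDepthWild` of the U4Keys organ (ED. 11 :266):
`v` ramified in `L` AND `¬ ∀ w′, |2|_{w′} = 1` — the wildly ramified dyadic places, where NO integral trace-one element exists (★ p862457, ★ (W-0) `R90S1WildTraceOneMinimal`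
§2) and the minimal one has `|t| = |ϖ|^{−δ}`, `δ = d − 1 ≥ 1` the DEFECT (`d` the different exponent).  Author R90-C10-p05 (g3).  `--supports stmt-HodgeConjecture-24833 --as helper`;
THEOREMS ONLY (no `def` ∕ `instance` ∕ `notation` ∕ named fact ∕ `sorry`); MODEL level = ★ (O1) §4's frame VERBATIM (`U(σ, Φ₃)(K)`, `Valued K ℤᵐ⁰`, an isometric involution `σ`,
a uniformiser `ϖ`, D174's letters `(e, Jg, hJg)`); the trace-one element and its defect are LETTERS `(ht) (htmin) (hδ : |t|·|ϖ|^δ ≤ 1)` (dealer's word; discharged at a place by ★ (W-0)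
`exists_traceOne_min` and the different — not here).  NOT THE PAYER of :182 and NOT a type theorem (flag below).

THE POINT.  In sub-branch (R-a) of Branch B — `hRa : ∀ u, σu = u → |u| = 1 → χ₁ u = 1` (the model spelling of ★ (a′)-R `R90S1BposRamShellsVanishOfRecord`'s `hRa0`) — the
`σ`-fixed conductor letter `hcondF` of ★ (O1) holds at EVERY level, so in ★ (O1) §4 `chi_apply_zero_zero_mul_of_concave_min` one may take `c := 1` and the long-root constraint
`c ≤ e 0 2 + e 2 0` is free; the two `|t|`-weighted inequalities `|t|·|ϖ|^(s + 2r′) ≤ |ϖ|ⁿ`, `|t|·|ϖ|^(s′ + 2r) ≤ |ϖ|ⁿ` follow from the DEFECT LETTER `|t|·|ϖ|^δ ≤ 1` and the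
ℕ-inequalities `n + δ ≤ s + 2r′`, `n + δ ≤ s′ + 2r` (§2).  With Roche's short-root split `r + r′ = n` and D174's concavity `s ≤ 2r`, `s′ ≤ 2r′`, `r ≤ s + r′`, `r′ ≤ s′ + r`, summing the
two inequalities gives `2δ ≤ s + s′ ≤ 2n`: a concave solution exists IFF `δ ≤ n`, and the MINIMAL long-root choice (largest group) is
  `r := ⌊n∕2⌋`, `r′ := ⌈n∕2⌉`, `s := r − r′ + δ`, `s′ := r′ − r + δ` (`s + s′ = 2δ`)   (§1, pure `omega`).
So for `1 ≤ δ ≤ n` the two-depth group `J_e` of ★ D174 exists and `θ(j) := χ₁(j₀₀)` is multiplicative on it (§3).  Below the window (`n < δ`) nothing passes — K2E3-p34 (g3)'s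
`ℚ₂(√2)` θ-cocycle (`K2/K2E3-p34/g3/CENSUS-182-wild.md` (a)(iii)); this file is silent there.
* §1 `wildRa_exponents` — the explicit exponents and their twelve (in)equalities (ℕ arithmetic).
* §2 `apply_eq_one_of_fixed_of_v_sub_one_le` (`hRa ⟹ hcondF` at every level `c ≥ 1`), `v_mul_pow_le_pow_of_defect` (`|t|·|ϖ|^δ ≤ 1`, `n + δ ≤ k ⟹ |t|·|ϖ|ᵏ ≤ |ϖ|ⁿ`),
  **`chi_apply_zero_zero_mul_of_fixTrivial_of_defect`** (THE HEAD: ★ (O1) §4 at `c := 1` under `hRa` and the defect letter; general `(e, Jg, hJg)`).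
* §3 **`exists_levelGroup_theta_mul_of_fixTrivial_of_defect`** (`1 ≤ δ ≤ n ⟹ ∃ (r,s;r′,s′), r + r′ = n ∧ s + s′ = 2δ ∧ 1 ≤ r′ ∧ 1 ≤ s′ ∧ ∃ Jg, hJg ∧ θ multiplicative on Jg`).
CONSUMER (census §4): the Road-I base case (K2E3-p34 (g3) offer (O2) `K2E3RankOneIntertwiningTestVector`, unbuilt): it binds exactly `(e, Jg, hJg)` with N̄-side `≥ 1` (⇒ ★
`K2E3IwahoriTwoDepthLettersCM.exists_iwahoriDatum_K_zero_eq_levelGroup` ∕ ★ D174 `coe_eq_mul`) and θ MULTIPLICATIVE (⇒ the `J_e`-test vector `f_e(pj) := (χδ^½)(p)·θ(j)` is well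
defined); at a wild (R-a) place this file is its only place-sensitive input (`hvt ↦ (htmin, hδ, hδn)`).
HONEST FLAG (dealer: «put flag (i) in the module docstring so no consumer over-reads the head»).  θ-MULTIPLICATIVE ≠ TYPE: nothing here claims `dim i(χ₁,1)^{(J_e, θ)} = 2` (the
cell ∕ witness cover of ★ `K2E3BranchAIrreducibleTwoDepth`-style D-I engines).  At long-root depth `s + s′ = 2δ ≥ 2 > cond_F(χ₁) ≤ 1` this is K2E3-p34 (g3)'s «road (III): UNKNOWN
and unprinted» (the Z-witness family needs a `σ`-fixed `u₂` with `χ₁ u₂ ≠ 1`, which (R-a) DENIES); so this file feeds (O2) (no cover needed) and the `hθmul` slot of a future wild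
(R-a) determinant road, and NOTHING else.  (O2) is the base case of Road I's (M3) only; Road I stays XL ((M2) return map + (M4), [Shahidi1990 §8]).
HONEST LABEL: HC_CM is proved only modulo the 7 printed citations (2 remaining named inputs: hLiu418 = stmt-HodgeConjecture-24832, h413 = stmt-HodgeConjecture-24833)
until rung 0 closes; count-neutral — this file pays no socket and closes nothing; (S-W) stays the XL residual of :182; no printed citation is discharged.

## References
* [Tits1979] J. Tits, *Reductive groups over local fields*, Proc. Sympos. Pure Math. 33.1 (1979), §1.15 (the ramified quasi-split `SU₃`, the trace constant), §3.7.
* [BruhatTits1972] F. Bruhat, J. Tits, *Groupes réductifs sur un corps local I*, Publ. Math. IHÉS 41 (1972), §6.4, (4.4.4), (6.4.9) (concave functions, `P_f = U_f⁻ H U_f⁺`).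
* [Roche1998] A. Roche, *Types and Hecke algebras for principal series representations of split reductive p-adic groups*, Ann. Sci. ÉNS (4) 31 (1998), §3 (`f_χ`, `J_χ`, Lemma 3.2).
* [MoyPrasad1996] A. Moy, G. Prasad, *Jacquet functors and unrefined minimal K-types*, Comment. Math. Helv. 71 (1996), §3.
* [Serre1979] J.-P. Serre, *Local Fields*, GTM 67 (1979), Ch. III §3 Prop. 7 (`Tr(𝔭_E^k) = 𝔭_F^{⌊(k+d)∕2⌋}`: the defect `δ = d − 1`).
* [Shahidi1990] F. Shahidi, *A proof of Langlands' conjecture on Plancherel measures; complementary series for p-adic groups*, Ann. of Math. 132 (1990), §8 (Road I, priced only).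
-/

set_option autoImplicit false
-- the mandated namespace repeats the single-problem summit's segment (`HodgeConjecture.HodgeConjecture`)
set_option linter.dupNamespace false

noncomputable section

open Matrix Literature.NumberTheory.Automorphic Literature.NumberTheory.Automorphic.UnitaryGroup
open scoped Matrix MatrixGroups WithZero

namespace Summit.HodgeConjecture.HodgeConjecture.R90.S1.WildConcaveLevelDatumRa

open Summit.HodgeConjecture.HodgeConjecture.Cruxes.H413
open Summit.HodgeConjecture.HodgeConjecture.Cruxes.H413.K2E3ConcaveLevelIwahoriCharacterMin
open Summit.HodgeConjecture.HodgeConjecture.Cruxes.H413.K2E3IwahoriTwoDepthFactorisation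

/-! ## §1 The exponents: `r + r' = n`, `s + s' = 2δ`, concave, N̄-side positive, and the two defect inequalities — solvable iff `δ ≤ n` -/

/-- **THE (R-a)-WILD EXPONENTS.**  For `1 ≤ δ ≤ n` the choice `r := ⌊n∕2⌋`, `r' := ⌈n∕2⌉`, `s := r − r' + δ`, `s' := r' − r + δ` satisfies: Roche's short-root split `r + r' = n`;
minimal long-root total `s + s' = 2δ`; N̄-side positivity `1 ≤ r'`, `1 ≤ s'`; D174's four concavity (triangle) inequalities `s ≤ 2r`, `s' ≤ 2r'`, `r ≤ s + r'`, `r' ≤ s' + r`;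
the two DEFECT inequalities `n + δ ≤ s + 2r'`, `n + δ ≤ s' + 2r` (which turn ★ (O1)'s `|t|`-weighted letters into consequences of `|t|·|ϖ|^δ ≤ 1`); and the alignment `r ≤ r' ≤ r + 1`.
Summing the two defect inequalities against concavity shows `2δ ≤ s + s' ≤ 2n` for ANY solution, so `δ ≤ n` is also necessary (not formalised: nothing consumes it).
[cite: BruhatTits1972, §6.4, (6.4.9)] [cite: Roche1998, §3, Lemma 3.2] [cite: Tits1979, §1.15] -/
theorem wildRa_exponents {n δ : ℕ} (hδ1 : 1 ≤ δ) (hδn : δ ≤ n) :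
    ∃ r s r' s' : ℕ, r + r' = n ∧ s + s' = 2 * δ ∧ 1 ≤ r' ∧ 1 ≤ s' ∧
      s ≤ 2 * r ∧ s' ≤ 2 * r' ∧ r ≤ s + r' ∧ r' ≤ s' + r ∧
      n + δ ≤ s + 2 * r' ∧ n + δ ≤ s' + 2 * r ∧ r ≤ r' ∧ r' ≤ r + 1 := by
  refine ⟨n / 2, n / 2 + δ - (n - n / 2), n - n / 2, (n - n / 2) + δ - n / 2, ?_, ?_, ?_, ?_, ?_, ?_, ?_, ?_, ?_, ?_, ?_, ?_⟩ <;> omega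

/-! ## §2 The head: ★ (O1) §4 at `c := 1` under (R-a) and the defect letter -/

section Model

variable {K : Type*} [Field K] [Valued K ℤᵐ⁰] [ValuativeRel K] [(Valued.v : Valuation K ℤᵐ⁰).Compatible]
  (σ : K →+* K) {ϖ : K} {J : Matrix (Fin 3) (Fin 3) K} (hJ : J = (StdForm.antidiagonal 3).over K)
  (hσ : ∀ a, σ (σ a) = a) (hvσ : ∀ a, Valued.v (σ a) = Valued.v a) (hvϖ : Valued.v ϖ = WithZero.exp (-1 : ℤ))

omit [ValuativeRel K] [(Valued.v : Valuation K ℤᵐ⁰).Compatible] in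
include hvϖ in
/-- **(R-a) GIVES THE `σ`-FIXED CONDUCTOR LETTER AT EVERY LEVEL.**  If `χ₁` is trivial on the `σ`-fixed units (`hRa : σu = u → |u| = 1 → χ₁ u = 1` — sub-branch (R-a) of
Branch B, the model spelling of ★ (a′)-R's `hRa0`), then for every `c ≥ 1` it is trivial on the `σ`-fixed `{u : σu = u, |u − 1| ≤ |ϖ|^c}` — ★ (O1)'s letter `hcondF` — since
`|u − 1| ≤ |ϖ|^c < 1` forces `|u| = 1`. [cite: Roche1998, §3] [cite: Serre1979, Ch. III §3] -/
theorem apply_eq_one_of_fixed_of_v_sub_one_le (χ₁ : Kˣ →* ℂˣ)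
    (hRa : ∀ u : Kˣ, σ (u : K) = u → Valued.v (u : K) = 1 → χ₁ u = 1) {c : ℕ} (hc1 : 1 ≤ c)
    (u : Kˣ) (hσu : σ (u : K) = u) (hu : Valued.v ((u : K) - 1) ≤ Valued.v ϖ ^ c) : χ₁ u = 1 := by
  have hvϖ1 : Valued.v ϖ < 1 := by rw [hvϖ, ← WithZero.exp_zero, WithZero.exp_lt_exp]; norm_num
  have hlt : Valued.v ((u : K) - 1) < 1 := hu.trans_lt (pow_lt_one' hvϖ1 (Nat.one_le_iff_ne_zero.1 hc1))
  refine hRa u hσu ?_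
  have h := Valued.v.map_one_add_of_lt hlt
  rwa [add_sub_cancel] at h

omit [ValuativeRel K] [(Valued.v : Valuation K ℤᵐ⁰).Compatible] in
include hvϖ in
/-- **THE DEFECT LETTER FEEDS ★ (O1)'s `|t|`-WEIGHTED INEQUALITIES**: from `|t|·|ϖ|^δ ≤ 1` and `n + δ ≤ k` one gets `|t|·|ϖ|ᵏ ≤ |ϖ|ⁿ` (`|ϖ|ᵏ ≤ |ϖ|^(n+δ)`, then split
`|ϖ|^(n+δ) = |ϖ|^δ·|ϖ|ⁿ`).  At a wild place `|t| = |ϖ|^{−δ}` with `δ = d − 1` and this is an equality of exponents; at a tame ∕ unramified place `δ = 0` and it is ★ (O1)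
`v_mul_pow_le_pow_of_v_le_one`. [cite: Tits1979, §1.15] [cite: Serre1979, Ch. III §3 Prop. 7] [cite: BruhatTits1972, (6.4.9)] -/
theorem v_mul_pow_le_pow_of_defect {t : K} {δ : ℕ} (hδ : Valued.v t * Valued.v ϖ ^ δ ≤ 1) {n k : ℕ} (hk : n + δ ≤ k) :
    Valued.v t * Valued.v ϖ ^ k ≤ Valued.v ϖ ^ n :=
  calc Valued.v t * Valued.v ϖ ^ k
      ≤ Valued.v t * Valued.v ϖ ^ (n + δ) := mul_le_mul' le_rfl (pow_le_pow_right_of_le_one' (v_uniformiser_le_one hvϖ) hk)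
    _ = (Valued.v t * Valued.v ϖ ^ δ) * Valued.v ϖ ^ n := by rw [pow_add, mul_comm (Valued.v ϖ ^ n), mul_assoc]
    _ ≤ 1 * Valued.v ϖ ^ n := mul_le_mul' hδ le_rfl
    _ = Valued.v ϖ ^ n := one_mul _

variable (e : Fin 3 → Fin 3 → ℕ) (Jg : Subgroup ↥(unitaryGroupOfForm σ J))
  (hJg : ∀ k : ↥(unitaryGroupOfForm σ J), k ∈ Jg ↔ ∀ i j, Valued.v (((k : GL (Fin 3) K) : Matrix (Fin 3) (Fin 3) K) i j) ≤ Valued.v ϖ ^ e i j)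

include hJ hσ hvσ hvϖ hJg in
/-- **THE HEAD — `θ(j) := χ₁(j₀₀)` IS MULTIPLICATIVE ON THE TWO-DEPTH GROUP `Jg` IN SUB-BRANCH (R-a), MINIMAL-`t`-WITH-DEFECT FORM.**  Exponent matrix `e` with `1 ≤ e 1 0`,
`1 ≤ e 2 0` and D174's membership letter `hJg`; `χ₁ : Kˣ → ℂˣ` trivial on `{u : |u − 1| ≤ |ϖ|ⁿ}` (cond_E `≤ n`) and on the `σ`-FIXED UNITS (`hRa`, sub-branch (R-a)); a MINIMAL
trace-one `t` (`ht`, `htmin` — ★ (W-0) `exists_traceOne_min`'s conjuncts) with DEFECT bound `hδ : |t|·|ϖ|^δ ≤ 1`; and the exponent inequalities `n ≤ e 0 1 + e 1 0`,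
`n + δ ≤ e 0 2 + 2·e 1 0`, `n + δ ≤ e 2 0 + 2·e 0 1`.  Then `χ₁((jj′)₀₀) = χ₁(j₀₀)·χ₁(j′₀₀)` for `j, j′ ∈ Jg` — ONE application of ★ (O1) `chi_apply_zero_zero_mul_of_concave_min`
at `c := 1` (`hcondF` from `hRa`, §2; the weighted inequalities from `hδ`, §2; `1 ≤ e 0 2 + e 2 0` from `1 ≤ e 2 0`).  Conclusion and the `(e, Jg, hJg) hj hj′ h0 h10 h20` bytes are
★ (O1) §4's VERBATIM.  NOT a type theorem (module docstring flag). [cite: Roche1998, §3] [cite: Tits1979, §1.15] [cite: MoyPrasad1996, §3] [cite: BruhatTits1972, (6.4.9)] -/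
theorem chi_apply_zero_zero_mul_of_fixTrivial_of_defect (h10e : 1 ≤ e 1 0) (h20e : 1 ≤ e 2 0) (χ₁ : Kˣ →* ℂˣ) {n δ : ℕ}
    (hcond : ∀ u : Kˣ, Valued.v ((u : K) - 1) ≤ Valued.v ϖ ^ n → χ₁ u = 1)
    (hRa : ∀ u : Kˣ, σ (u : K) = u → Valued.v (u : K) = 1 → χ₁ u = 1)
    {t : K} (ht : t + σ t = 1) (htmin : ∀ a : K, a + σ a = 1 → Valued.v t ≤ Valued.v a)
    (hδ : Valued.v t * Valued.v ϖ ^ δ ≤ 1)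
    (h1 : n ≤ e 0 1 + e 1 0) (h2 : n + δ ≤ e 0 2 + 2 * e 1 0) (h3 : n + δ ≤ e 2 0 + 2 * e 0 1)
    {j j' : ↥(unitaryGroupOfForm σ J)} (hj : j ∈ Jg) (hj' : j' ∈ Jg)
    (h0 : (((j * j' : ↥(unitaryGroupOfForm σ J)) : GL (Fin 3) K) : Matrix (Fin 3) (Fin 3) K) 0 0 ≠ 0)
    (h10 : (((j : GL (Fin 3) K) : Matrix (Fin 3) (Fin 3) K) 0 0) ≠ 0) (h20 : (((j' : GL (Fin 3) K) : Matrix (Fin 3) (Fin 3) K) 0 0) ≠ 0) :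
    χ₁ (Units.mk0 _ h0) = χ₁ (Units.mk0 _ h10) * χ₁ (Units.mk0 _ h20) :=
  chi_apply_zero_zero_mul_of_concave_min σ hJ hσ hvσ hvϖ e Jg hJg h10e h20e χ₁ (c := 1) le_rfl hcond
    (fun u hσu hu => apply_eq_one_of_fixed_of_v_sub_one_le σ hvϖ χ₁ hRa le_rfl u hσu hu) ht htmin h1
    (v_mul_pow_le_pow_of_defect hvϖ hδ h2) (v_mul_pow_le_pow_of_defect hvϖ hδ h3) (le_add_left h20e) hj hj' h0 h10 h20

/-! ## §3 Existence: for `1 ≤ δ ≤ n` a θ-multiplicative two-depth datum with `r + r' = n`, `s + s' = 2δ` -/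

include hJ hσ hvσ hvϖ in
/-- **A θ-MULTIPLICATIVE CONCAVE LEVEL DATUM EXISTS IN SUB-BRANCH (R-a) AT DEFECT `δ ≤ n`** (the census sentence «(R-a), `n ≥ δ`: a concave level datum `e` exists via ★ (O1) +
concavity, `2δ ≤ s + s′ ≤ 2n`» as a theorem).  For `χ₁` of cond_E `≤ n` trivial on the `σ`-fixed units, a minimal trace-one `t` with `|t|·|ϖ|^δ ≤ 1`, and `1 ≤ δ ≤ n`: there are
exponents `(r, s; r′, s′)` with `r + r′ = n`, `s + s′ = 2δ`, `1 ≤ r′`, `1 ≤ s′` (§1) and a subgroup `Jg ≤ U(σ, Φ₃)` cut out by the two-depth test for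
`e = ![![0, r, s], ![r′, 0, r], ![s′, r′, 0]]` (★ D174 `exists_subgroup_forall_mem_iff_twoDepth`) on which `θ(j) := χ₁(j₀₀)` is multiplicative (§2).  Tame ∕ unramified places
(`δ = 0`, `e = (ν, 0; ν, 1)`) are ★ already and excluded by `1 ≤ δ`; below the window (`n < δ`) no datum exists and none is claimed.  NOT a type theorem.
[cite: Roche1998, §3, Lemma 3.2] [cite: BruhatTits1972, §6.4, (6.4.9)] [cite: Tits1979, §1.15] [cite: MoyPrasad1996, §3] -/
theorem exists_levelGroup_theta_mul_of_fixTrivial_of_defect (χ₁ : Kˣ →* ℂˣ) {n δ : ℕ} (hδ1 : 1 ≤ δ) (hδn : δ ≤ n)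
    (hcond : ∀ u : Kˣ, Valued.v ((u : K) - 1) ≤ Valued.v ϖ ^ n → χ₁ u = 1)
    (hRa : ∀ u : Kˣ, σ (u : K) = u → Valued.v (u : K) = 1 → χ₁ u = 1)
    {t : K} (ht : t + σ t = 1) (htmin : ∀ a : K, a + σ a = 1 → Valued.v t ≤ Valued.v a)
    (hδ : Valued.v t * Valued.v ϖ ^ δ ≤ 1) :
    ∃ r s r' s' : ℕ, r + r' = n ∧ s + s' = 2 * δ ∧ 1 ≤ r' ∧ 1 ≤ s' ∧
      ∃ Jg : Subgroup ↥(unitaryGroupOfForm σ J),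
        (∀ k : ↥(unitaryGroupOfForm σ J), k ∈ Jg ↔ ∀ i j, Valued.v (((k : GL (Fin 3) K) : Matrix (Fin 3) (Fin 3) K) i j) ≤
          Valued.v ϖ ^ (![![0, r, s], ![r', 0, r], ![s', r', 0]] : Fin 3 → Fin 3 → ℕ) i j) ∧
        ∀ (j j' : ↥(unitaryGroupOfForm σ J)), j ∈ Jg → j' ∈ Jg →
          ∀ (h0 : (((j * j' : ↥(unitaryGroupOfForm σ J)) : GL (Fin 3) K) : Matrix (Fin 3) (Fin 3) K) 0 0 ≠ 0)
            (h10 : (((j : GL (Fin 3) K) : Matrix (Fin 3) (Fin 3) K) 0 0) ≠ 0) (h20 : (((j' : GL (Fin 3) K) : Matrix (Fin 3) (Fin 3) K) 0 0) ≠ 0),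
            χ₁ (Units.mk0 _ h0) = χ₁ (Units.mk0 _ h10) * χ₁ (Units.mk0 _ h20) := by
  obtain ⟨r, s, r', s', hrr, hss, hr', hs', hs2, hs'2, hrc, hr'c, h2, h3, -, -⟩ := wildRa_exponents hδ1 hδn
  obtain ⟨Jg, hJg⟩ := exists_subgroup_forall_mem_iff_twoDepth σ hJ hvσ hvϖ hs2 hs'2 hrc hr'c
  refine ⟨r, s, r', s', hrr, hss, hr', hs', Jg, hJg, fun j j' hj hj' h0 h10 h20 => ?_⟩
  exact chi_apply_zero_zero_mul_of_fixTrivial_of_defect σ hJ hσ hvσ hvϖ _ Jg hJg hr' hs' χ₁ hcond hRa ht htmin hδ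
    (show n ≤ r + r' by omega) (show n + δ ≤ s + 2 * r' from h2) (show n + δ ≤ s' + 2 * r from h3) hj hj' h0 h10 h20

end Model

end Summit.HodgeConjecture.HodgeConjecture.R90.S1.WildConcaveLevelDatumRa

end
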